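import Literature.MathematicalPhysics.QuantumFieldTheory.Balaban1983to89.B9B8KnitLetterXDiffMajorant
import Literature.MathematicalPhysics.QuantumFieldTheory.Balaban1983to89.B9B8KnitLetterProjectionC

/-!
# `Balaban1983to89.B9B8KnitLetterCinvTransfer` — [B9] THM 3.2 (3.48) AT PRINT's KNIT LETTER FROM (3.48) AT def-Y's LETTER OF RECORD: the resolvent expansion
# `X_knit⁻¹ = X_sym⁻¹ + X_knit⁻¹·(X_sym − X_knit)·X_sym⁻¹` (`X = Q′G′²Q′*`, `C = X⁻¹`) realified and scaled, its remainder `R = F·T₀` majorised weight-free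
# (`F = η⁴(X_sym − X_knit)` from file 23b, `T₀ = η⁻⁴X_sym⁻¹` from Thm 3.2 at `parSymY`), and [4] (2.66) ⟹ the (3.48) block majorant `K′·ℓ(a)⁻⁴·e^{−δ′d}` of
# `η⁻⁴C(U; parKnitY)` — the knit consumer's `hC` binder (junction J-B file 23c, seat p33; the C-line twin of file 9)

statement-level skeleton of published theorems with citation tags; proofs where landed; nothing here is a claim about the
Yang–Mills mass gap

T. Bałaban, *Propagators for lattice gauge theories in a background field*, Commun. Math. Phys. **99** (1985) 389–434 [`Balaban1985BackgroundPropagators`,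
"[B9]"]; T. Bałaban, *Propagators and renormalization transformations for lattice gauge theories. II*, Commun. Math. Phys. **96** (1984) 223–250
[`Balaban1984PropagatorsII`, "[4]"]; T. Bałaban, *Averaging operations for lattice gauge theories*, Commun. Math. Phys. **98** (1985) 17–51
[`Balaban1985Averaging`, "[B7]"].

THE PRINT.  [B9] Thm 3.2 (3.48) p. 398 («|(Q′G′²Q′*)⁻¹(U; y, y′)| ≦ O(1)(Lʲη)⁻⁴ exp(−δd(y,y′))»), (3.25) p. 395, (3.19) p. 393 (the knit letter «(52), (53) in [5]»),
(3.90) pp. 409–410 («expansions … convergent in all norms»), (3.95)–(3.96) p. 411; [4] Prop. 2.2 (2.50)–(2.52) p. 232 (the second resolvent identity and the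
kernel calculus), (2.65)–(2.67) p. 234 (the Neumann series majorant, «with a decay rate arbitrarily close»), (2.83)–(2.85) p. 237; [B7] (52)–(53) pp. 26–27.

WHY THIS FILE ∕ THE ARGUMENT.  Sub-row G-B9-LETTERS proves (3.48) at def-Y's letter of record `parSymY` (p21's M5.6, seat p33's FILE 10
`B9Thm32CinvAtMemberOfCubeData.cinv_at_member_of_cubeData_unitary`: `conj b(η⁻⁴X_sym⁻¹) ≺ K·ℓ(a)⁻⁴·e^{−δd}` on the block carrier), while the knit consumer
(`B8Thm2TorusLetters.LettersAt`, junction files 17–19, RECORD-JB-g95 §«How the assembler uses this») displays `hC` at print's transporters `parKnitY`.  Both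
`X_sym`, `X_knit` are units (p21's `isUnit_XY_parSymY`, J-B 13's `isUnit_XY_parKnitY` — NO new invertibility hypothesis), so [4] (2.50):
`X_knit⁻¹ = X_sym⁻¹ + X_knit⁻¹(X_sym − X_knit)X_sym⁻¹`; with `T := conj b(η⁻⁴X_knit⁻¹)`, `T₀ := conj b(η⁻⁴X_sym⁻¹)`, `F := conj b(η⁴(X_sym − X_knit))` this is the
fixed-point equation `T = T₀ + T·(F·T₀)` of [4] (2.66); `F ≺ θ_F·ℓ⁴·e^{−δd}` (file 23b, `θ_F = O(α₀′)`) and `T₀ ≺ K·ℓ⁻⁴·e^{−δd}` give the WEIGHT-FREE remainder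
`R = F·T₀ ≺ θ_FKL⁴c₁·e^{−δ′d}` (scale transfer of `ℓ⁻⁴`, (2.61); `ℓ⁴·ℓ⁻⁴ = 1`), and `majorant_of_fixedPoint_266` under the displayed smallness `θ_R·c₁ < 1`
(located in `α₀′`, file 9's precedent) yields `T ≺ K·c₁(1 − θ_Rc₁)⁻¹·ℓ(a)⁻⁴·e^{−(1−α)δ′d}` — token-identical to the consumer's `hC` shape.

CITATION HEADER (lean-in-tree rule).  Cell `lit-balaban`, sub-row G-B9-LETTERS, junction J-B file 23c → seat `lit-balaban-p33` gen 98.  REUSED BY NAME: J-B 8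
`B9B8KnitLetterResolvent.inverse_eq_add_of_isUnit'`, p21 `B9Thm311PosAtRecordV4.isUnit_XY_parSymY`, J-B 13 `B9B8KnitLetterProjectionC.isUnit_XY_parKnitY`, r03
`B6RandomWalk.majorant_of_fixedPoint_266`, p21 F3a `B9Thm39CinvUpperL.hasMajorant_mul_weighted`, J-B 23b `B9B8KnitLetterXDiffMajorant.{hasMajorant_rate_mono,
rate_le, hasMajorant_conj_XY_sym_sub_knit}`, `B9Eq352DivFormLetters.{conj, conj_mul}`, `B9Eq352GradLetters.conj_add`, def-Y `Node00.{XY, XinvY, GpY, parSymY, etaS}`.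
INPUTS CONSUMED IN THE LANDED SHAPES: `hT₀` = FILE 10's conclusion verbatim (`K·(ℓ(a)⁴)⁻¹·e^{−δd}` on `(s, j) ↦ ιB s`); `hF` = file 23b's conclusion with its
explicit `θ_F` abbreviated to one binder `θF ≥ 0` and its rate `δ″` renamed `δ` (the assembler weakens both inputs to the common rate by `hasMajorant_rate_mono`).

WHAT THIS FILE PROVES (sorry-free; no definitions).
* §1 `XinvY_parKnitY_eq'` (the second resolvent identity for `C` at the two letters, from the two landed `IsUnit`s), ★ `conj_fixedPoint_Xinv` (realified, scaled:
  `T = T₀ + T·(F·T₀)`), `len4_mul_inv` (`ℓ⁴·(ℓ⁴)⁻¹ = 1`).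
* §2 ★ `hasMajorant_remainder` — `F·T₀ ≺ θ_FKL⁴c₁·e^{−(1−α′)(1−α_st)δd}` weight-free (displayed `hF`, `hT₀`, scale transfer of `ℓ⁻⁴`, (2.61)).
* §3 ★★★ **`hasMajorant_conj_XinvY_parKnitY_of_parSymY`** — for `G ≤ U(N)`, a `G`-valued `U` with `G`-valued knit legs, displayed `hF`, `hT₀`, geometry ((2.54),
  `d(y,y) = 0`, `d ≥ 0`, scale transfer of `ℓ⁻⁴` at `(δ, α_st, C)`, (2.61) at `((1−α_st)δ, α′)`, (2.61)∕(2.63) at `(δ′, α)` with `δ′ = (1−α′)(1−α_st)δ`,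
  `(1−α)δ′ ≥ 0`) and the smallness `θ_FKCc₁((1−α_st)δ,α′)·c₁(δ′,α) < 1`:
  `conj b(η⁻⁴·X(U; parKnitY)⁻¹) ≺ K·c₁(δ′,α)·(1 − θ_FKCc₁c₁(δ′,α))⁻¹·(ℓ(a)⁴)⁻¹·e^{−(1−α)δ′d(a,a′)}` on `(s, j) ↦ ιB s`.
* §4 ★★★ `hasMajorant_conj_XinvY_parKnitY_of_letters` — §3 with `hF` discharged by file 23b: from the (3.42)₁ majorants of `η²G′` at the two letters, the diagonal
  majorant of `η⁻²(Δ′_sym − Δ′_knit)`, FILE 10's `hT₀` (all at one displayed rate `δ`), the class (52) and print's units — (3.48) at `parKnitY` at the rate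
  `(1−α)(1−α′)³(1−α_st)³δ`.

HONEST SCOPE.  Composition of landed results; the smallness `θ_R·c₁ < 1` is DISPLAYED (it is `O(α₀′)`-small by file 23b's `θ_F`, not discharged numerically here —
file 9's located-smallness precedent); the rate degrades as in [4] (2.66) («arbitrarily close» not pursued); constants explicit, unoptimised.  Nothing of Thm 3.2 at
`parSymY` is re-proved (FILE 10 ∕ M5.6 are the suppliers of `hT₀`); count-neutral; nothing continuum, nothing about OS axioms or the mass gap.  No `sorry`, no `axiom`,
no `… : Prop` fact, no `instance`, no `notation`, no `def`.  NEW file; nothing landed is modified.  Net new unproved facts: 0.  Seat `lit-balaban-p33` gen 98,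
2026-08-28.  RELATED, NOT DUPLICATED (searched 2026-08-28: `lean search 'XinvY_parKnitY_eq|conj_fixedPoint_Xinv|XinvY_parKnitY_of_parSymY' --decl` = ∅): file 9
`hasMajorant_conj_GpY_parKnitY_of_parSymY` (the `G′` twin, same architecture), J-B 13 (`C` at the knit letter: invertibility and positivity, no majorant).
-/

noncomputable section

namespace Literature.MathematicalPhysics.QuantumFieldTheory.Balaban1983to89.B9B8KnitLetterCinvTransfer

open Node00
open B6Geom246MultiLevelBox (blkOf)
open B6KLevelCensusIndexV1 (KIdx)
open B6RandomWalk (HasMajorant Triangle254 Ineq261 Ineq263 hasMajorant_mono majorant_of_fixedPoint_266 c1_nonneg)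
open B9Thm34Ext (toB6)
open B9GeoNormsKLevelV1 (geo9K)
open B9GeoLemma21KLevelV1 (geo9K_len_pos)
open B9Ineq347 (ScaleTransfer)
open B9Eq352DivFormLetters (conj)
open B9Eq352GradLetters (conj_add)
open B9Thm39CinvUpperL (hasMajorant_mul_weighted)
open B9B8KnitLetterResolvent (inverse_eq_add_of_isUnit')
open B9Thm311PosAtRecordV4 (isUnit_XY_parSymY)
open B9B8KnitLetterProjectionC (isUnit_XY_parKnitY)
open B9B8KnitLetterXDiffMajorant (hasMajorant_rate_mono rate_le hasMajorant_conj_XY_sym_sub_knit)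
open B7Prop2Explicit (AvgClosed pdev C0 c2' unitaryUnits)
open B9B8CarrierDictionary (liftCfg)
open B9B8AveragingJunction (parKnitY)
open B9B8KnitLetterRegular (parKnitY_mem_of_pdev)
open scoped Matrix Matrix.Norms.L2Operator

variable {d ℓ : ℕ} {hd : 1 ≤ d + 1} {hL : Odd (ℓ + 1) ∧ 1 < ℓ + 1} {b₀ b₁ : ℝ}
variable (i : KIdx d ℓ hd hL b₀ b₁) {N : ℕ} {G : Subgroup (Matrix (Fin N) (Fin N) ℂ)ˣ}
variable {ι : Type} [Fintype ι] [DecidableEq ι] (b : Module.Basis ι ℝ (Matrix (Fin N) (Fin N) ℂ))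
variable [Fintype (geo9K i).Site] [DecidableEq (geo9K i).Site] {Rr : ℝ} {Hp : Prop} (ιB : BlkY i → IBondY i)

/-! ## §1 The second resolvent identity for `C = (Q′G′²Q′*)⁻¹` at the two letters -/

omit [Fintype ι] [DecidableEq ι] [Fintype (geo9K i).Site] [DecidableEq (geo9K i).Site] in
/-- [4] (2.50) for `X = Q′G′²Q′*` at def-Y's letter and at the knit letter (both units: p21's `isUnit_XY_parSymY`, J-B 13's `isUnit_XY_parKnitY`):
`X_knit⁻¹ = X_sym⁻¹ + X_knit⁻¹·(X_sym − X_knit)·X_sym⁻¹`. [cite: Balaban1984PropagatorsII, (2.50) p.232; Balaban1985BackgroundPropagators, (3.25) p.395, (3.90) p.409] -/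
theorem XinvY_parKnitY_eq' (hG : G ≤ unitaryUnits (Matrix (Fin N) (Fin N) ℂ)) {U : CfgY (Matrix (Fin N) (Fin N) ℂ) i}
    (hU : ∀ μ x, U μ x ∈ G) (hpar : ∀ z w : SiteY i, parKnitY i U z w ∈ G) :
    XinvY i (parKnitY i) (GpY i (parKnitY i)) U = XinvY i (parSymY i) (GpY i (parSymY i)) U
      + XinvY i (parKnitY i) (GpY i (parKnitY i)) U * (XY i (parSymY i) (GpY i (parSymY i)) U - XY i (parKnitY i) (GpY i (parKnitY i)) U)
        * XinvY i (parSymY i) (GpY i (parSymY i)) U :=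
  inverse_eq_add_of_isUnit' (isUnit_XY_parSymY i hG hU) (isUnit_XY_parKnitY i hG hU hpar)

omit [DecidableEq ι] [Fintype (geo9K i).Site] [DecidableEq (geo9K i).Site] in
/-- ★ THE REALIFIED, SCALED FIXED-POINT IDENTITY `T = T₀ + T·(F·T₀)` with `T = conj b(s⁻¹X_knit⁻¹)`, `T₀ = conj b(s⁻¹X_sym⁻¹)`, `F = conj b(s(X_sym − X_knit))`, `s ≠ 0`.
[cite: Balaban1984PropagatorsII, (2.50) p.232, (2.52) p.232, (2.66) p.234; Balaban1985BackgroundPropagators, (3.90) p.409] -/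
theorem conj_fixedPoint_Xinv (hG : G ≤ unitaryUnits (Matrix (Fin N) (Fin N) ℂ)) {U : CfgY (Matrix (Fin N) (Fin N) ℂ) i}
    (hU : ∀ μ x, U μ x ∈ G) (hpar : ∀ z w : SiteY i, parKnitY i U z w ∈ G) {s : ℝ} (hs : s ≠ 0) :
    conj b (s⁻¹ • (XinvY i (parKnitY i) (GpY i (parKnitY i)) U).restrictScalars ℝ)
      = conj b (s⁻¹ • (XinvY i (parSymY i) (GpY i (parSymY i)) U).restrictScalars ℝ)
        + conj b (s⁻¹ • (XinvY i (parKnitY i) (GpY i (parKnitY i)) U).restrictScalars ℝ)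
          * (conj b (s • ((XY i (parSymY i) (GpY i (parSymY i)) U).restrictScalars ℝ - (XY i (parKnitY i) (GpY i (parKnitY i)) U).restrictScalars ℝ))
            * conj b (s⁻¹ • (XinvY i (parSymY i) (GpY i (parSymY i)) U).restrictScalars ℝ)) := by
  set Tk : Module.End ℝ (BlkY i → Matrix (Fin N) (Fin N) ℂ) := (XinvY i (parKnitY i) (GpY i (parKnitY i)) U).restrictScalars ℝ with hTk
  set Ts : Module.End ℝ (BlkY i → Matrix (Fin N) (Fin N) ℂ) := (XinvY i (parSymY i) (GpY i (parSymY i)) U).restrictScalars ℝ with hTs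
  set D : Module.End ℝ (BlkY i → Matrix (Fin N) (Fin N) ℂ) :=
    (XY i (parSymY i) (GpY i (parSymY i)) U).restrictScalars ℝ - (XY i (parKnitY i) (GpY i (parKnitY i)) U).restrictScalars ℝ with hD
  -- §1's identity restricted to real scalars (all `restrictScalars` lemmas are `rfl`)
  have hfixℝ : Tk = Ts + Tk * D * Ts := congrArg (LinearMap.restrictScalars ℝ) (XinvY_parKnitY_eq' i hG hU hpar)
  have hprod : (s • D) * (s⁻¹ • Ts) = D * Ts := by
    rw [smul_mul_assoc, mul_smul_comm, smul_smul, mul_inv_cancel₀ hs, one_smul]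
  have key : s⁻¹ • Tk = s⁻¹ • Ts + (s⁻¹ • Tk) * ((s • D) * (s⁻¹ • Ts)) := by
    rw [hprod, smul_mul_assoc, ← mul_assoc, ← smul_add]
    exact congrArg (s⁻¹ • ·) hfixℝ
  conv_lhs => rw [key]
  rw [conj_add, B9Eq352DivFormLetters.conj_mul, B9Eq352DivFormLetters.conj_mul]

omit [Fintype ι] [DecidableEq ι] [Fintype (geo9K i).Site] [DecidableEq (geo9K i).Site] in
/-- `ℓ(a)⁴·(ℓ(a)⁴)⁻¹ = 1` on the member's geometry (`ℓ > 0`). [cite: Balaban1985BackgroundPropagators, (3.47)–(3.48) p.398, bookkeeping] -/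
theorem len4_mul_inv (a : (geo9K i).Site) : (geo9K i).len a ^ 4 * ((geo9K i).len a ^ 4)⁻¹ = 1 :=
  mul_inv_cancel₀ (pow_ne_zero 4 (geo9K_len_pos i a).ne')

/-! ## §2 The remainder `R = F·T₀` is weight-free -/

omit [Fintype ι] [DecidableEq ι] [DecidableEq (geo9K i).Site] in
/-- ★ **THE REMAINDER `F·T₀ ≺ θ_FKCc₁·e^{−(1−α′)(1−α_st)δd}`, WEIGHT-FREE**: `F ≺ θ_F·ℓ⁴·e^{−δd}` (file 23b's shape) and `T₀ ≺ K·ℓ⁻⁴·e^{−δd}` (FILE 10's shape) on the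
block carrier; the weight `ℓ⁻⁴` of the middle point moves to the left point by the scale transfer (constant `C = L⁴`), the middle sum is (2.61), and `ℓ⁴·ℓ⁻⁴ = 1`.
[cite: Balaban1984PropagatorsII, (2.52) p.232, (2.60)–(2.61) p.234, (2.83)–(2.85) p.237; Balaban1985BackgroundPropagators, Thm 3.2 (3.48) p.398, (3.95) p.411] -/
theorem hasMajorant_remainder {F T₀ : Module.End ℝ (BlkY i × ι → ℝ)} (d₁ : ℕ) {δ αst α' C θF K : ℝ} (hθF : 0 ≤ θF) (hK : 0 ≤ K) (hC : 0 ≤ C)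
    (hαδ : 0 ≤ αst * δ) (hα'0 : 0 ≤ α') (hα'1 : α' ≤ 1) (hδ' : 0 ≤ (1 - αst) * δ)
    (htri : Triangle254 (toB6 (geo9K i) Rr Hp)) (hdnn : ∀ a a' : (geo9K i).Site, 0 ≤ (geo9K i).dist a a')
    (hST : ScaleTransfer (geo9K i) δ αst C (fun a => ((geo9K i).len a ^ 4)⁻¹))
    (h261 : Ineq261 d₁ (toB6 (geo9K i) Rr Hp) ((1 - αst) * δ) α')
    (hF : HasMajorant (g := toB6 (geo9K i) Rr Hp) (fun q : BlkY i × ι => ιB q.1) F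
      (fun a a' => θF * (geo9K i).len a ^ 4 * Real.exp (-(δ * (geo9K i).dist a a'))))
    (hT₀ : HasMajorant (g := toB6 (geo9K i) Rr Hp) (fun q : BlkY i × ι => ιB q.1) T₀
      (fun a a' => K * ((geo9K i).len a ^ 4)⁻¹ * Real.exp (-(δ * (geo9K i).dist a a')))) :
    HasMajorant (g := toB6 (geo9K i) Rr Hp) (fun q : BlkY i × ι => ιB q.1) (F * T₀)
      (fun a a' => θF * K * C * B6.c1 d₁ ((1 - αst) * δ) α' * Real.exp (-((1 - α') * ((1 - αst) * δ) * (geo9K i).dist a a'))) := by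
  have hw₁ : ∀ a : (geo9K i).Site, 0 ≤ (geo9K i).len a ^ 4 := fun a => pow_nonneg (geo9K_len_pos i a).le 4
  have hw₂ : ∀ a : (geo9K i).Site, 0 ≤ ((geo9K i).len a ^ 4)⁻¹ := fun a => inv_nonneg.2 (hw₁ a)
  refine hasMajorant_mono _ (hasMajorant_mul_weighted (g := geo9K i) (R := Rr) (H := Hp) (fun q : BlkY i × ι => ιB q.1) d₁
    (fun a => (geo9K i).len a ^ 4) (fun a => ((geo9K i).len a ^ 4)⁻¹) hθF hK hC hw₁ hw₂ hαδ hα'0 hα'1 hδ' htri hdnn hST h261 hF hT₀) fun a a' => le_of_eq ?_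
  rw [len4_mul_inv, mul_one]

/-! ## §3 ★★★ (3.48) at the knit letter from (3.48) at def-Y's letter -/

omit [DecidableEq (geo9K i).Site] in
/-- ★★★ **[B9] THM 3.2 (3.48) AT PRINT's KNIT LETTER FROM (3.48) AT def-Y's LETTER OF RECORD.**  For `G ≤ U(N)`, a `G`-valued `U` whose knit legs are `G`-valued
(class (52): J-B 4b), a real basis `b`; DISPLAYED: the block majorant `θ_F·ℓ(a)⁴·e^{−δd}` of `F = conj b(η⁴(X_sym − X_knit))` (file 23b), the (3.48) majorant
`K·(ℓ(a)⁴)⁻¹·e^{−δd}` of `T₀ = conj b(η⁻⁴X_sym⁻¹)` (FILE 10 ∕ M5.6), the member's geometry ((2.54), `d(y,y) = 0`, `d ≥ 0`, scale transfer of `ℓ⁻⁴` at `(δ, α_st, C)`,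
(2.61) at `((1−α_st)δ, α′)`, (2.61)∕(2.63) at `(δ′, α)` with `δ′ = (1−α′)(1−α_st)δ`, `(1−α)δ′ ≥ 0`) and the smallness `θ_R·c₁(δ′,α) < 1`, `θ_R = θ_FKCc₁((1−α_st)δ,α′)`.
THEN `conj b(η⁻⁴·X(U; parKnitY)⁻¹) ≺ K·c₁(δ′,α)·(1 − θ_Rc₁(δ′,α))⁻¹·(ℓ(a)⁴)⁻¹·e^{−(1−α)δ′d(a,a′)}` on the block carrier `(s, j) ↦ ιB s` — the knit consumer's `hC`.
[cite: Balaban1985BackgroundPropagators, Thm 3.2 (3.48) p.398, (3.19) p.393, (3.25) p.395, (3.90) pp.409–410; Balaban1984PropagatorsII, Prop. 2.2 (2.50)–(2.52) p.232, (2.66)–(2.67) p.234; Balaban1985Averaging, (52)–(53) pp.26–27] -/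
theorem hasMajorant_conj_XinvY_parKnitY_of_parSymY (hG : G ≤ unitaryUnits (Matrix (Fin N) (Fin N) ℂ)) {U : CfgY (Matrix (Fin N) (Fin N) ℂ) i}
    (hU : ∀ μ x, U μ x ∈ G) (hparK : ∀ z w : SiteY i, parKnitY i U z w ∈ G)
    (d₁ d₂ : ℕ) {δ αst α' α C θF K : ℝ} (hθF : 0 ≤ θF) (hK : 0 ≤ K) (hC : 0 ≤ C)
    (hαδ : 0 ≤ αst * δ) (hα'0 : 0 ≤ α') (hα'1 : α' ≤ 1) (hδ' : 0 ≤ (1 - αst) * δ) (hαδ' : 0 ≤ (1 - α) * ((1 - α') * ((1 - αst) * δ)))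
    (htri : Triangle254 (toB6 (geo9K i) Rr Hp)) (hrefl : ∀ y : (geo9K i).Site, (geo9K i).dist y y = 0)
    (hdnn : ∀ a a' : (geo9K i).Site, 0 ≤ (geo9K i).dist a a')
    (hST : ScaleTransfer (geo9K i) δ αst C (fun a => ((geo9K i).len a ^ 4)⁻¹))
    (h261 : Ineq261 d₁ (toB6 (geo9K i) Rr Hp) ((1 - αst) * δ) α')
    (h261' : Ineq261 d₂ (toB6 (geo9K i) Rr Hp) ((1 - α') * ((1 - αst) * δ)) α)
    (h263' : Ineq263 d₂ (toB6 (geo9K i) Rr Hp) ((1 - α') * ((1 - αst) * δ)) α)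
    (hsmall : θF * K * C * B6.c1 d₁ ((1 - αst) * δ) α' * B6.c1 d₂ ((1 - α') * ((1 - αst) * δ)) α < 1)
    (hF : HasMajorant (g := toB6 (geo9K i) Rr Hp) (fun q : BlkY i × ι => ιB q.1)
      (conj b ((etaS i ^ 2 * etaS i ^ 2) • ((XY i (parSymY i) (GpY i (parSymY i)) U).restrictScalars ℝ -
        (XY i (parKnitY i) (GpY i (parKnitY i)) U).restrictScalars ℝ)))
      (fun a a' => θF * (geo9K i).len a ^ 4 * Real.exp (-(δ * (geo9K i).dist a a'))))
    (hT₀ : HasMajorant (g := toB6 (geo9K i) Rr Hp) (fun q : BlkY i × ι => ιB q.1)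
      (conj b ((etaS i ^ 2 * etaS i ^ 2)⁻¹ • (XinvY i (parSymY i) (GpY i (parSymY i)) U).restrictScalars ℝ))
      (fun a a' => K * ((geo9K i).len a ^ 4)⁻¹ * Real.exp (-(δ * (geo9K i).dist a a')))) :
    HasMajorant (g := toB6 (geo9K i) Rr Hp) (fun q : BlkY i × ι => ιB q.1)
      (conj b ((etaS i ^ 2 * etaS i ^ 2)⁻¹ • (XinvY i (parKnitY i) (GpY i (parKnitY i)) U).restrictScalars ℝ))
      (fun a a' => K * B6.c1 d₂ ((1 - α') * ((1 - αst) * δ)) α *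
          (1 - θF * K * C * B6.c1 d₁ ((1 - αst) * δ) α' * B6.c1 d₂ ((1 - α') * ((1 - αst) * δ)) α)⁻¹ *
        ((geo9K i).len a ^ 4)⁻¹ * Real.exp (-((1 - α) * ((1 - α') * ((1 - αst) * δ)) * (geo9K i).dist a a'))) := by
  classical
  set δ' : ℝ := (1 - α') * ((1 - αst) * δ) with hδ'def
  set θR : ℝ := θF * K * C * B6.c1 d₁ ((1 - αst) * δ) α' with hθRdef
  have hθR : 0 ≤ θR := mul_nonneg (mul_nonneg (mul_nonneg hθF hK) hC) (c1_nonneg _ _ _)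
  have hw₂ : ∀ a : (geo9K i).Site, 0 ≤ ((geo9K i).len a ^ 4)⁻¹ := fun a => inv_nonneg.2 (pow_nonneg (geo9K_len_pos i a).le 4)
  -- the remainder at the rate `δ′`, weight-free
  have hR := hasMajorant_remainder i ιB (Rr := Rr) (Hp := Hp) d₁ hθF hK hC hαδ hα'0 hα'1 hδ' htri hdnn hST h261 hF hT₀
  -- `T₀` at the rate `δ′`
  have hT₀' := hasMajorant_rate_mono i (Rr := Rr) (Hp := Hp) (fun q : BlkY i × ι => ιB q.1) (fun a => ((geo9K i).len a ^ 4)⁻¹) hK hw₂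
    (rate_le hαδ hα'0 hδ') hT₀
  -- the fixed-point equation and [4] (2.66)
  have hs : etaS i ^ 2 * etaS i ^ 2 ≠ 0 := by
    have h := (B9Ineq349SiteComposite.etaS_pos i).ne'
    positivity
  have hfix := conj_fixedPoint_Xinv i b hG hU hparK hs
  exact majorant_of_fixedPoint_266 (fun q : BlkY i × ι => ιB q.1) d₂ δ' α θR K (fun a => ((geo9K i).len a ^ 4)⁻¹) hK hw₂ hθR hαδ' htri hrefl hdnn
    h261' h263' hsmall hT₀' hR hfix

/-! ## §4 ★★★ From the letters: §3 with file 23b's `F`-majorant plugged in -/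

/-- ★★★ **(3.48) AT THE KNIT LETTER FROM THE LETTERS OF RECORD** — §3 with `hF` discharged by file 23b's `hasMajorant_conj_XY_sym_sub_knit`: for `G ≤ U(N)`
averaging-closed, `N ≥ 1`, a `G`-valued `U` on [B7]'s class (52) (`pdev (liftCfg U) < α₀′(L^k)⁻²`, `0 < α₀′`, `C₀α₀′ ≤ ⅓`, `2α₀′ ≤ c₂′`), print's units `c_f = L^k`, a
real basis `b` with coordinate bound `M₂`; DISPLAYED at ONE rate `δ`: the (3.42)₁ site majorants `A_s·ℓ²·e^{−δd}`, `A_k·ℓ²·e^{−δd}` of `η²G′` at the two letters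
(FILE 9 ∕ M5.5, file 9), the diagonal majorant `θ_E·𝟙` of `η⁻²(Δ′_sym − Δ′_knit)` (file 9 §1), FILE 10's (3.48) majorant `K·ℓ⁻⁴·e^{−δd}` of `η⁻⁴X_sym⁻¹`; the
geometry ((2.54), `d(y,y)=0`, `d ≥ 0`, scale transfers of `ℓ²` at `δ`, `δ′` (constant `C`) and of `ℓ⁻⁴` at `δ″` (constant `C₄`), (2.61) at `((1−α_st)δ, α′)`,
`((1−α_st)δ′, α′)`, `((1−α_st)δ″, α′)`, (2.61)∕(2.63) at `(δ‴, α)`; `δ′ = (1−α′)(1−α_st)δ`, `δ″ = (1−α′)(1−α_st)δ′`, `δ‴ = (1−α′)(1−α_st)δ″`) and the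
smallness `θ_F·K·C₄·c₁((1−α_st)δ″,α′)·c₁(δ‴,α) < 1` with file 23b's `θ_F`.  THEN
`conj b(η⁻⁴X(U; parKnitY)⁻¹) ≺ K·c₁(δ‴,α)·(1 − θ_FKC₄c₁c₁(δ‴,α))⁻¹·(ℓ(a)⁴)⁻¹·e^{−(1−α)δ‴d}` on `(s, j) ↦ ιB s`.
[cite: Balaban1985BackgroundPropagators, Thm 3.2 (3.48) p.398, Thm 3.1 (3.42) p.397, (3.19) p.393, (3.25) p.395, (3.90) pp.409–410, (3.95) p.411; Balaban1984PropagatorsII, (2.50)–(2.52) p.232, (2.60)–(2.61) p.234, (2.66)–(2.67) p.234, (2.83) p.237; Balaban1985Averaging, (52)–(53) pp.26–27] -/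
theorem hasMajorant_conj_XinvY_parKnitY_of_letters [Nonempty (Fin N)] (hG : G ≤ unitaryUnits (Matrix (Fin N) (Fin N) ℂ)) (hGa : AvgClosed (d + 1) (ℓ + 1) G)
    {U : CfgY (Matrix (Fin N) (Fin N) ℂ) i} (hU : ∀ μ x, U μ x ∈ G) {α₀' : ℝ} (hα : 0 < α₀') (hα3 : C0 (d + 1) * α₀' ≤ 1 / 3)
    (hα2 : 2 * α₀' ≤ c2' (d + 1) (ℓ + 1)) (h52 : pdev (liftCfg U) < α₀' * ((((ℓ + 1 : ℕ) : ℝ) ^ i.k)⁻¹) ^ 2)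
    (hcf : i.cf = (((ℓ + 1 : ℕ) : ℝ)) ^ i.k)
    {M₂ : ℝ} (hM₂ : 0 ≤ M₂) (hrepr : ∀ (v : Matrix (Fin N) (Fin N) ℂ) (j : ι), |b.repr v j| ≤ M₂ * ‖v‖)
    (d₁ d₂ d₃ d₄ : ℕ) {δ αst α' α C C₄ As Ak θE K : ℝ} (hAs : 0 ≤ As) (hAk : 0 ≤ Ak) (hθE : 0 ≤ θE) (hK : 0 ≤ K) (hC : 0 ≤ C) (hC₄ : 0 ≤ C₄)
    (hαδ : 0 ≤ αst * δ) (hα'0 : 0 ≤ α') (hα'1 : α' ≤ 1) (hδ' : 0 ≤ (1 - αst) * δ)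
    (hαδ₂ : 0 ≤ αst * ((1 - α') * ((1 - αst) * δ))) (hδ'₂ : 0 ≤ (1 - αst) * ((1 - α') * ((1 - αst) * δ)))
    (hαδ₃ : 0 ≤ αst * ((1 - α') * ((1 - αst) * ((1 - α') * ((1 - αst) * δ)))))
    (hδ'₃ : 0 ≤ (1 - αst) * ((1 - α') * ((1 - αst) * ((1 - α') * ((1 - αst) * δ)))))
    (hαδ₄ : 0 ≤ (1 - α) * ((1 - α') * ((1 - αst) * ((1 - α') * ((1 - αst) * ((1 - α') * ((1 - αst) * δ)))))))
    (htri : Triangle254 (toB6 (geo9K i) Rr Hp)) (hrefl : ∀ y : (geo9K i).Site, (geo9K i).dist y y = 0)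
    (hdnn : ∀ a a' : (geo9K i).Site, 0 ≤ (geo9K i).dist a a')
    (hST : ScaleTransfer (geo9K i) δ αst C (fun a => (geo9K i).len a ^ 2))
    (h261 : Ineq261 d₁ (toB6 (geo9K i) Rr Hp) ((1 - αst) * δ) α')
    (hST₂ : ScaleTransfer (geo9K i) ((1 - α') * ((1 - αst) * δ)) αst C (fun a => (geo9K i).len a ^ 2))
    (h261₂ : Ineq261 d₂ (toB6 (geo9K i) Rr Hp) ((1 - αst) * ((1 - α') * ((1 - αst) * δ))) α')
    (hST₃ : ScaleTransfer (geo9K i) ((1 - α') * ((1 - αst) * ((1 - α') * ((1 - αst) * δ)))) αst C₄ (fun a => ((geo9K i).len a ^ 4)⁻¹))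
    (h261₃ : Ineq261 d₃ (toB6 (geo9K i) Rr Hp) ((1 - αst) * ((1 - α') * ((1 - αst) * ((1 - α') * ((1 - αst) * δ))))) α')
    (h261₄ : Ineq261 d₄ (toB6 (geo9K i) Rr Hp) ((1 - α') * ((1 - αst) * ((1 - α') * ((1 - αst) * ((1 - α') * ((1 - αst) * δ)))))) α)
    (h263₄ : Ineq263 d₄ (toB6 (geo9K i) Rr Hp) ((1 - α') * ((1 - αst) * ((1 - α') * ((1 - αst) * ((1 - α') * ((1 - αst) * δ)))))) α)
    (hsmall : ((2 * (8 * ((d : ℝ) + 1) ^ 2 * α₀') * (M₂ * ∑ j, ‖b j‖)) * (M₂ * ∑ j, ‖b j‖) * (As * As * C * B6.c1 d₁ ((1 - αst) * δ) α') +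
          (M₂ * ∑ j, ‖b j‖) * (M₂ * ∑ j, ‖b j‖) *
            ((As + Ak) * (Ak * (θE * As) * C * B6.c1 d₁ ((1 - αst) * δ) α') * C * B6.c1 d₂ ((1 - αst) * ((1 - α') * ((1 - αst) * δ))) α') +
          (M₂ * ∑ j, ‖b j‖) * ((2 * (8 * ((d : ℝ) + 1) ^ 2 * α₀') * (M₂ * ∑ j, ‖b j‖))) * (Ak * Ak * C * B6.c1 d₁ ((1 - αst) * δ) α')) * K * C₄ *
        B6.c1 d₃ ((1 - αst) * ((1 - α') * ((1 - αst) * ((1 - α') * ((1 - αst) * δ))))) α' *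
        B6.c1 d₄ ((1 - α') * ((1 - αst) * ((1 - α') * ((1 - αst) * ((1 - α') * ((1 - αst) * δ)))))) α < 1)
    (hE : HasMajorant (g := toB6 (geo9K i) Rr Hp) (fun p : SiteY i × ι => ιB (blkOf i.D.toDomains p.1))
      (conj b ((etaS i ^ 2)⁻¹ • (deltaPrimeAY i (parSymY i) U - deltaPrimeAY i (parKnitY i) U).restrictScalars ℝ))
      (fun a a' : (geo9K i).Site => if a = a' then θE else 0))
    (hGs : HasMajorant (g := toB6 (geo9K i) Rr Hp) (fun p : SiteY i × ι => ιB (blkOf i.D.toDomains p.1))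
      (conj b ((etaS i ^ 2) • (GpY i (parSymY i) U).restrictScalars ℝ)) (fun a a' => As * (geo9K i).len a ^ 2 * Real.exp (-(δ * (geo9K i).dist a a'))))
    (hGk : HasMajorant (g := toB6 (geo9K i) Rr Hp) (fun p : SiteY i × ι => ιB (blkOf i.D.toDomains p.1))
      (conj b ((etaS i ^ 2) • (GpY i (parKnitY i) U).restrictScalars ℝ)) (fun a a' => Ak * (geo9K i).len a ^ 2 * Real.exp (-(δ * (geo9K i).dist a a'))))
    (hT₀ : HasMajorant (g := toB6 (geo9K i) Rr Hp) (fun q : BlkY i × ι => ιB q.1)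
      (conj b ((etaS i ^ 2 * etaS i ^ 2)⁻¹ • (XinvY i (parSymY i) (GpY i (parSymY i)) U).restrictScalars ℝ))
      (fun a a' => K * ((geo9K i).len a ^ 4)⁻¹ * Real.exp (-(δ * (geo9K i).dist a a')))) :
    HasMajorant (g := toB6 (geo9K i) Rr Hp) (fun q : BlkY i × ι => ιB q.1)
      (conj b ((etaS i ^ 2 * etaS i ^ 2)⁻¹ • (XinvY i (parKnitY i) (GpY i (parKnitY i)) U).restrictScalars ℝ))
      (fun a a' => K * B6.c1 d₄ ((1 - α') * ((1 - αst) * ((1 - α') * ((1 - αst) * ((1 - α') * ((1 - αst) * δ)))))) α *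
          (1 - ((2 * (8 * ((d : ℝ) + 1) ^ 2 * α₀') * (M₂ * ∑ j, ‖b j‖)) * (M₂ * ∑ j, ‖b j‖) * (As * As * C * B6.c1 d₁ ((1 - αst) * δ) α') +
              (M₂ * ∑ j, ‖b j‖) * (M₂ * ∑ j, ‖b j‖) *
                ((As + Ak) * (Ak * (θE * As) * C * B6.c1 d₁ ((1 - αst) * δ) α') * C * B6.c1 d₂ ((1 - αst) * ((1 - α') * ((1 - αst) * δ))) α') +
              (M₂ * ∑ j, ‖b j‖) * ((2 * (8 * ((d : ℝ) + 1) ^ 2 * α₀') * (M₂ * ∑ j, ‖b j‖))) * (Ak * Ak * C * B6.c1 d₁ ((1 - αst) * δ) α')) * K * C₄ *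
            B6.c1 d₃ ((1 - αst) * ((1 - α') * ((1 - αst) * ((1 - α') * ((1 - αst) * δ))))) α' *
            B6.c1 d₄ ((1 - α') * ((1 - αst) * ((1 - α') * ((1 - αst) * ((1 - α') * ((1 - αst) * δ)))))) α)⁻¹ *
        ((geo9K i).len a ^ 4)⁻¹ *
        Real.exp (-((1 - α) * ((1 - α') * ((1 - αst) * ((1 - α') * ((1 - αst) * ((1 - α') * ((1 - αst) * δ)))))) * (geo9K i).dist a a'))) := by
  have hparK : ∀ z w : SiteY i, parKnitY i U z w ∈ G := fun z w => parKnitY_mem_of_pdev i hGa hU hα hα3 hα2 h52 z w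
  have hSb : 0 ≤ ∑ j, ‖b j‖ := Finset.sum_nonneg fun _ _ => norm_nonneg _
  have hc₁ := c1_nonneg d₁ ((1 - αst) * δ) α'
  have hc₂ := c1_nonneg d₂ ((1 - αst) * ((1 - α') * ((1 - αst) * δ))) α'
  have hθF : 0 ≤ (2 * (8 * ((d : ℝ) + 1) ^ 2 * α₀') * (M₂ * ∑ j, ‖b j‖)) * (M₂ * ∑ j, ‖b j‖) * (As * As * C * B6.c1 d₁ ((1 - αst) * δ) α') +
      (M₂ * ∑ j, ‖b j‖) * (M₂ * ∑ j, ‖b j‖) *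
        ((As + Ak) * (Ak * (θE * As) * C * B6.c1 d₁ ((1 - αst) * δ) α') * C * B6.c1 d₂ ((1 - αst) * ((1 - α') * ((1 - αst) * δ))) α') +
      (M₂ * ∑ j, ‖b j‖) * ((2 * (8 * ((d : ℝ) + 1) ^ 2 * α₀') * (M₂ * ∑ j, ‖b j‖))) * (Ak * Ak * C * B6.c1 d₁ ((1 - αst) * δ) α') := by positivity
  -- file 23b: the `F`-majorant at the rate `δ″`
  have hF := hasMajorant_conj_XY_sym_sub_knit i b ιB (Rr := Rr) (Hp := Hp) hG hGa hU hα hα3 hα2 h52 hcf hM₂ hrepr d₁ d₂ hAs hAk hθE hC hαδ hα'0 hα'1 hδ'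
    hαδ₂ hδ'₂ htri hdnn hST h261 hST₂ h261₂ hE hGs hGk
  -- FILE 10's `T₀` weakened to the rate `δ″` (`δ″ ≤ δ′ ≤ δ`)
  have hw₂ : ∀ a : (geo9K i).Site, 0 ≤ ((geo9K i).len a ^ 4)⁻¹ := fun a => inv_nonneg.2 (pow_nonneg (geo9K_len_pos i a).le 4)
  have hle : (1 - α') * ((1 - αst) * ((1 - α') * ((1 - αst) * δ))) ≤ δ := (rate_le hαδ₂ hα'0 hδ'₂).trans (rate_le hαδ hα'0 hδ')
  have hT₀' := hasMajorant_rate_mono i (Rr := Rr) (Hp := Hp) (fun q : BlkY i × ι => ιB q.1) (fun a => ((geo9K i).len a ^ 4)⁻¹) hK hw₂ hle hT₀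
  exact hasMajorant_conj_XinvY_parKnitY_of_parSymY i b ιB hG hU hparK d₃ d₄ hθF hK hC₄ hαδ₃ hα'0 hα'1 hδ'₃ hαδ₄ htri hrefl hdnn hST₃ h261₃ h261₄ h263₄
    hsmall hF hT₀'

end Literature.MathematicalPhysics.QuantumFieldTheory.Balaban1983to89.B9B8KnitLetterCinvTransfer

end
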